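import Literature.AnabelianGeometry.EtaleTheta.BiKummerRootTwist
import Literature.AnabelianGeometry.EtaleTheta.BiKummerOfModelCanonical
import Literature.AlgebraicGeometry.Frobenioids.ModelFrobenioidPreSteps

/-!
# [EtTh] §4: the law binders of `FractionPair.twistUnit` / `NthRoot.twistUnit` DISCHARGED — disjoint supports and
# saturation for every setting, the fraction laws at abc-iut-L2-t9's canonical model (R192 sequel (2b), proof-only)

S. Mochizuki, *The étale theta function and its Frobenioid-theoretic manifestations*, Publ. RIMS **45** (2009)
[cite: MochizukiEtTh2009, Def 4.1 (i)(iii) p.312–313 (PDF pp.86–87); Prop 4.2 (iii) p.314 (PDF p.88)]; S. Mochizuki,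
*The geometry of Frobenioids I*, [FrdI] Thm. 5.2 (ii) p.101 (the model Frobenioid: `O^×(−)` on `C^birat` is `B`).

abc-iut cell, layer L2, row R192 sequel (2b) (seat abc-iut-f-121; spec abc-iut-L2-d4 10:13:09Z «the two law binders … as
THEOREMS at mkOfModel»).  PROOF-ONLY over `BiKummerRootTwist.lean` (p437955) and abc-iut-L2-t9's `BiKummerOfModelCanonical.lean`.

WHAT IS PROVED.
§1 For EVERY §4 setting `S` (its category IS a model Frobenioid, [EtTh] Def 3.6 (ii)), with `Φ` divisorial:
  * `div_comp_unit` — `Div(u ∘ s) = Div(s)` for an automorphism `u` ([FrdI] Thm 5.2 (ii): `Div` of an isomorphism is `0`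
    in a sharp monoid) ⇒ `disjointSupports_twistUnit` — the binder `hdisj`/`hdisjN` of `twistUnit` HOLDS (the supports of
    `(s′, u ∘ s″)` are those of `(s′, s″)`);
  * `isSaturated_twist_of_fixed` — the binder `hsat` of `NthRoot.twistUnit` REDUCES to the `H_{A_N}`-fixedness of
    `(α′)^* f′` (Def 4.1 (iii): ampleness and clause (a) do not mention the function; clause (b) is the twisted root `f′_N`
    itself by `hpow`) — the fixedness is the honest residual (print: the twisting unit is a CONSTANT `ζ·c`, Lemma 5.8).
§2 At the CANONICAL MODEL `mkOfModelCanonical` (`fracOf := fracOfModel = u_{s′}·u_{s″}⁻¹`, [FrdI] Thm 5.2 (ii)):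
  * `fracOf_comp_iso_mkOfModelCanonical` — `(s′ ≫ e)·(s″ ≫ e)⁻¹ = s′·(s″)⁻¹` for an isomorphism `e` (abc-iut-found's
    `ModelFrobenioid.frac_comp_of_degFr_eq_one`): the fraction is insensitive to re-anchoring the codomain — the law behind the
    anchor binder `hf` of `NthRoot.transport(At)`;
  * `fracOf_twistUnit_mul_mkOfModelCanonical` — `s′·(u ∘ s″)⁻¹ · (s″)^*(u_u) = s′·(s″)⁻¹` (`ModelFrobenioid.frac_comp_unit_mul`):
    the twisted function `f′` of `FractionPair.twistUnit` is `f` divided by the pulled-back rational function of the unit.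
HONEST FRAMING: kernel-checked laws of the model vocabulary; refereed pre-IUT material ([FrdI], [EtTh] §4); nothing here
bears on [IUTchIII] Cor. 3.12 or takes a side; typed ≠ proved for any genuine datum.
-/

namespace Literature.AnabelianGeometry.EtaleTheta

open CategoryTheory Opposite Literature.AlgebraicGeometry.Frobenioids

namespace BiKummerSetting

universe u₀ v₀ u v w

variable {K : Type u₀} [Field K] {D₀ : Type u₀} [Category.{v₀} D₀] {V : FrdIMonoidStub.{w}}
  {X₁ : SemiGraphs.TemperedArithmeticGroup.{u₀} K} {T₁ : RealifiedDivisorMonoids (D₀ := D₀) V}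
  {D₁ : Type u} [Category.{v} D₁] {VD₁ : FrdICatStub.{u, v, w} D₁} {S : BiKummerSetting X₁ T₁ D₁ VD₁}

/-! ### §1. Every setting: disjoint supports and saturation of the twist -/

/-- `Div(u ∘ s) = Div(s)` for an automorphism `u` of the codomain, `Φ` divisorial ([FrdI] Thm 5.2 (ii)).
[cite: MochizukiEtTh2009, Def 4.1 (i) p.313 (PDF p.87)] -/
theorem div_comp_unit (hΦd : Objectwise (fun M _ => IsDivisorial M) S.tf.divisorMonoid) {A B : S.C} (s : A ⟶ B)
    (u : Aut B) : S.div (s ≫ u.hom) = S.div s :=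
  ModelFrobenioid.div_comp_of_isIso hΦd s u.hom

/-- **The binder `hdisj` of `FractionPair.twistUnit` HOLDS for every setting with `Φ` divisorial**: the zero divisor and the
divisor of poles of `(s′, u ∘ s″)` are those of `(s′, s″)`. [cite: MochizukiEtTh2009, Def 4.1 (i) p.313 (PDF p.87)] -/
theorem disjointSupports_twistUnit (hΦd : Objectwise (fun M _ => IsDivisorial M) S.tf.divisorMonoid) {A B : S.C}
    {f : S.biratUnits A} (P : S.FractionPair f B) (u : Aut B) :
    S.DisjointSupports (S.div P.num) (S.div (P.den ≫ u.hom)) := by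
  rw [S.div_comp_unit hΦd P.den u]
  exact P.disjointSupports

/-- **The binder `hsat` of `NthRoot.twistUnit` REDUCES to fixedness**: `A_N` is `(N, H_⊙, (α′)^* f′)`-saturated as soon as
`(α′)^* f′` is fixed by `H_{A_N}` — ampleness and clause (a) of Def 4.1 (iii) come from the root `R`, clause (b) is the twisted
root `f′_N` (`hpow`). [cite: MochizukiEtTh2009, Def 4.1 (iii) p.313 (PDF p.87)] -/
theorem isSaturated_twist_of_fixed {A B : S.C} {f : S.biratUnits A} {P : S.FractionPair f B} {N : ℕ+}
    {pullFrac : ∀ {A A' : S.C} (_ : A' ⟶ A), S.biratUnits A → S.biratUnits A'} (R : S.NthRoot f P N pullFrac)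
    {f' : S.biratUnits A} {root' : S.biratUnits R.AN} (hpow : root' ^ (N : ℕ) = pullFrac R.αData.α₁ f')
    (hfix : S.IsFixedByHA R.AN R.isSaturated.isAmple.isGalois (pullFrac R.αData.α₁ f')) :
    S.IsSaturated R.AN N (pullFrac R.αData.α₁ f') where
  isAmple := R.isSaturated.isAmple
  fixed := hfix
  cond_a := R.isSaturated.cond_a
  cond_b := ⟨root', hpow⟩

/-! ### §2. The canonical model: the fraction laws ([FrdI] Thm 5.2 (ii)) -/

section Model

variable (X : SemiGraphs.TemperedArithmeticGroup.{u₀} K) {T : RealifiedDivisorMonoids (D₀ := D₀) V}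
  {D : Type u} [Category.{v} D] {VD : FrdICatStub.{u, v, w} D}
  (tf : TemperedFrobenioid T D VD) (hZ : tf.monoidType = MonoidType.Z)
  (hP : ∀ A : Dᵒᵖ, IsPerfect (tf.Φ.carrier A)) (IG : D → Prop) (gS : ∀ A : D, IG A → (X.Pi →* Aut A))
  (gSs : ∀ (A : D) (h : IG A), Function.Surjective (gS A h))
  (NH : Subgroup (Field.absoluteGaloisGroup K) → tf.category → ℕ+ → Prop) (A₀ : tf.category)
  (hA₀ : PreFrobenioid.IsFrobeniusTrivial tf.toElem A₀) (hA₀' : IG A₀.base)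

/-- The fraction of the canonical instance IS the model fraction `u_{s′}·u_{s″}⁻¹` (definitionally; abc-iut-L2-t9's
`mkOfModel_fracOf` for `mkOfModelCanonical`). [cite: MochizukiEtTh2009, Def 4.1 (i) p.312 (PDF p.86)] -/
theorem mkOfModelCanonical_fracOf {A B : tf.category} (s' s'' : A ⟶ B) (h' : PreFrobenioid.IsPreStep tf.toElem s')
    (h'' : PreFrobenioid.IsPreStep tf.toElem s'') (hb : PreFrobenioid.BaseEquivalent tf.toElem s' s'') :
    (mkOfModelCanonical X tf hZ hP IG gS gSs NH A₀ hA₀ hA₀').fracOf s' s'' h' h'' hb = tf.fracOfModel T.isUnit_BΛ s' s'' :=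
  rfl

end Model

end BiKummerSetting

namespace TemperedFrobenioid

universe u₀' v₀' u' v' w'

variable {D₀ : Type u₀'} [Category.{v₀'} D₀] {V : FrdIMonoidStub.{w'}} {T : RealifiedDivisorMonoids (D₀ := D₀) V}
  {D : Type u'} [Category.{v'} D] {VD : FrdICatStub.{u', v', w'} D} (C : TemperedFrobenioid T D VD)
  (hBΛ : ∀ (Y : D₀ᵒᵖ) (b : T.BΛ.obj Y), IsUnit b)

/-- **Re-anchoring the codomain along an isomorphism does not change the fraction** (model): for a base-equivalent pair
`s′, s″ : A → B` and an isomorphism `e : B ≅ B′`, `(s′ ≫ e)·(s″ ≫ e)⁻¹ = s′·(s″)⁻¹` in `O^×(A^birat) = B(A_D)^×` — abc-iut-found's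
`ModelFrobenioid.frac_comp_of_degFr_eq_one` (isomorphisms are linear): the law behind the anchor binder `hf` of
`NthRoot.transport(At)`. [cite: MochizukiEtTh2009, Def 4.1 (i) p.312 (PDF p.86)] -/
theorem fracOfModel_comp_iso {A B B' : C.category} (s' s'' : A ⟶ B)
    (hb : PreFrobenioid.BaseEquivalent C.toElem s' s'') (e : B ≅ B') :
    C.fracOfModel hBΛ (s' ≫ e.hom) (s'' ≫ e.hom) = C.fracOfModel hBΛ s' s'' :=
  ModelFrobenioid.frac_comp_of_degFr_eq_one _ s' s'' hb (PreFrobenioid.isLinear_of_isIso C.toElem e.hom)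

/-- **The twisted function at the model**: for `u ∈ O^×(B)`, `s′·(u ∘ s″)⁻¹ · (s″)^*(u_u) = s′·(s″)⁻¹` in `O^×(A^birat)` — so the
`f′` of `FractionPair.twistUnit` is `f` divided by the pulled-back rational function of the unit (abc-iut-found's
`ModelFrobenioid.frac_comp_unit_mul`). [cite: MochizukiEtTh2009, Def 4.1 (i) p.312 (PDF p.86)] -/
theorem fracOfModel_twistUnit_mul {A B : C.category} (s' s'' : A ⟶ B) (u : Aut B) (hu : u ∈ ModelFrobenioid.units B) :
    C.fracOfModel hBΛ s' (s'' ≫ u.hom) *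
        (C.isUnit_ratFnFunctor hBΛ A (pull C.ratFnFunctor (ModelFrobenioid.baseMap s'') (ModelFrobenioid.unit u.hom))).unit =
      C.fracOfModel hBΛ s' s'' :=
  ModelFrobenioid.frac_comp_unit_mul _ s' s'' hu

end TemperedFrobenioid

end Literature.AnabelianGeometry.EtaleTheta
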